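import Summits.HodgeConjecture.HodgeConjecture.Theorems.HLiu418S1MultOneFormsOfLetters
import Summits.HodgeConjecture.HodgeConjecture.Theorems.HLiu418S1BettiSliceExclusionNecPos   -- PORT-3 (LA1-p03): (X) on the ORIENTED necessity letters E3nec₂-pos (#74R)
import Summits.HodgeConjecture.HodgeConjecture.Theorems.HLiu418E3NecessityPos   -- PORT-2 (LA1-p03): E3nec-antihol-pos ⇐ E3nec-hol-pos (#74R)
import Summits.HodgeConjecture.HodgeConjecture.Theorems.F0AlbCmS1BettiHolds
import Summits.HodgeConjecture.HodgeConjecture.Theorems.HLiu418S1BettiSliceLinesTheta   -- T3: (L10)/(L01) on the θ-restricted letter E1θ₂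
import Summits.HodgeConjecture.HodgeConjecture.Theorems.HLiu418E1Theta   -- T2: E1θantihol ⇐ E1θhol
import HarnessLib

/-!
PORT-5a (GEN A-p18 (g32); «LD2» LD2-plan (g0) deal 03:32:29Z (b); LEAD «LD-R1» #74R): the `_pos` TWIN of ★ `Theorems/F0AlbCmS1BettiHoldsSignedThetaNec.lean` —
the two E3 necessity hypotheses are the ORIENTED letters ★ `Rogawski1990.curveThetaHodgeTypeNecessity_hol_pos ∕ _antihol_pos` (#74R, ED. 2 of
`Literature/NumberTheory/Rogawski1990/CurveThetaHodgeTypeNecessity.lean`, p848618: the binders `(hτt : 0 < (ι t).re) (hτt' : (ι t).im = 0)` inserted after `(ht : t ≠ 0)`),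
the (X) input is PORT-3 ★ `S1BettiSliceExclusionNecPos.stub_X_of_nec_letters_pos` (LA1-p03) and the antihol necessity is derived by PORT-2 ★
`E3NecessityPos.curveThetaHodgeTypeNecessity_antihol_pos_of_hol_pos` (LA1-p03); everything else VERBATIM (the consumer binder lists already carry `hτt hτt'`).  Heads:
`s1MultOneForms_of_theta_nec_letters_pos`, `stub_S1_betti_holds_theta_nec_pos`, `stub_S1_betti_holds_theta_nec_pos_of_hol_pos` — conclusions TOKEN FOR TOKEN those of the
unsigned twin (`F0AlbCmS1BettiHolds.S1BettiShape`).  The unsigned file stays as settled content.  Original header follows.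

# Crux `HLiu418`, line `F0_AlbCm` ∕ sub-sub-line `F0_AlbCmS1Betti` — ROAD (A) twin ON THE θ-RESTRICTED E1-LETTER AND THE NECESSITY E3-LETTERS:
# `stub_S1_betti_holds_theta_nec : S1BettiShape` MODULO {E1θhol₂, E3nec-hol₂, E3nec-antihol₂, D₂h, E₂h} and `…_of_hol` MODULO {E1θhol₂, E3nec-hol₂, D₂h, E₂h}
# — twin of ★ `Theorems/F0AlbCmS1BettiHoldsSignedTheta.lean` (T4, p812797) with the E3 hypotheses weakened to ★ `Rogawski1990.curveThetaHodgeTypeNecessity_hol ∕ _antihol`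

Floor-0 programme P5 (Alb-CM), seat F0P5-p02 (g4) («T4′b» of the P5 desk's word #11, 2026-08-31); crux item stmt-HodgeConjecture-24832 (`HCCMUnconditional.HLiu418`).
THEOREMS ONLY, def-free, `sorry`-free; named-fact inputs are HYPOTHESES BY THEIR LITERATURE NAMES.  HC_CM is proved only modulo the 7 printed citations until rung 0
closes.  = ★ T4 `F0AlbCmS1BettiHoldsSignedTheta.lean` VERBATIM except: header, the two E3 hypothesis TYPES (signed biconditionals ↦ necessity letters
«occurrence ∧ admissible ⇒ sign of `e♮`», [Liu2021, Rem. D.5] «only if» half), names, and the (X) input ★ `S1BettiSliceExclusionSigned.stub_X_of_signed_letters` ↦ ★ T3′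
`S1BettiSliceExclusionNec.stub_X_of_nec_letters` (census F0P5-p02 (g4) `F0/P5/p02/CENSUS-E3-direction.v1`, desk word #11); plus `…_of_hol` with the antihol necessity
DERIVED by ★ T1′ `E3NecessityPos.curveThetaHodgeTypeNecessity_antihol_pos_of_hol_pos`.

CENSUS (for the books): in the parent `Lines/F0_AlbCm.lean` the packaged stubs `stub_S1_facts` ∕ `stub_S1b_facts` have exactly the consumers `stub_S1_betti` (both)
and `stub_S1b_hodge` (`stub_S1b_facts`); below those slots the kernel chain consumes the E1-letter only at `σ := ω⋆_lab`, `j := id` (E1θhol₂) and the E3-letters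
only in the directions «adm → `e♮ ∈ Φ_λ`» (hol) ∕ «`e♮ ∈ Φ_λ` → ¬adm» (antihol) under the admissibility supplied by `_hadm` (E3nec₂).  So the parent may read
(the desk's ED. 10) `theorem stub_S1_facts : Rogawski1990.curveThetaCohFinComponentUnique_hol := by sorry`,
`theorem stub_S1b_facts : Rogawski1990.curveThetaHodgeTypeNecessity_hol := by sorry`, with
`stub_S1_betti := F0AlbCmS1BettiHoldsSignedThetaNec.stub_S1_betti_holds_theta_nec stub_S1_facts stub_S1b_facts (E3NecessityPos.curveThetaHodgeTypeNecessity_antihol_pos_of_hol_pos stub_S1b_facts) F0P5TP2Holds.… E2LevelFinite.…`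
(or the 4-argument `…_of_hol`).  BOOKS: roster {E1θhol₂, E3nec-hol₂} + D9op = «multiplicity ≤ 1» + «sign necessity» for the theta representations
`ω(λ, ε_a, χ)` — [Liu2021, Prop. D.4 (1) + Rem. D.5] with NO existence ∕ construction half owed.

`s1MultOneForms_of_theta_nec_letters_pos` = ★ T4 `s1MultOneForms_of_theta_letters` VERBATIM with (X) from ★ T3′; `stub_S1_betti_holds_theta_nec` = ★
`F0AlbCmS1BettiHolds.s1BettiShape_of` at ★ `stub_S1_realisation` and this head; conclusion `F0AlbCmS1BettiHolds.S1BettiShape` (= parent `F0AlbCm.S1BettiShape` token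
for token).

## References
* [Liu2021] Y. Liu, Camb. J. Math. 9 (2021): Prop. D.4 (1) and proof (p. 130–131); Rem. D.5 (p. 131); Lem. D.1 (2); Lem. D.2 (3).
* [Rogawski1990] Ann. of Math. Stud. 123: §11.1 Prop. 11.1.1; Thm. 11.5.1; §12.3; Thm. 13.3.5 and 13.3.7.  [HarrisKudlaSweet1996] Thm. 6.1.
* [Dixmier1977] §5.4 (5.4.1), §13.1.  [BorelJacquet1979] PSPM 33.1, §4.6.  [BorelWallach2000] VII 2.10, 3.2 and 3.6.
-/

set_option autoImplicit false
-- the mandated namespace repeats `HodgeConjecture.HodgeConjecture`, as in every `Theorems/*.lean` of this sub-problem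
set_option linter.dupNamespace false

noncomputable section

namespace Summit.HodgeConjecture.HodgeConjecture.Cruxes.HLiu418.F0AlbCmS1BettiHoldsSignedThetaNecPos

open scoped TensorProduct Matrix NumberField Kronecker ComplexOrder InnerProductSpace ENNReal
open MeasureTheory
open NumberField NumberField.InfinitePlace IsDedekindDomain
open Summit.HodgeConjecture.CorCM.Model Summit.HodgeConjecture.CorCM.Model.HComp Summit.HodgeConjecture.CorCM.HComp
open Literature.AlgebraicGeometry.Motives (CMType AbelianVariety)
open Literature.AlgebraicGeometry.ShimuraVarieties Literature.AlgebraicGeometry.ShimuraVarieties.UnitaryCanonicalModel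
open Literature.NumberTheory.Automorphic Literature.NumberTheory.Automorphic.UnitaryGroup Literature.NumberTheory.Automorphic.UnitaryCurveForms
open Literature.NumberTheory.Automorphic.UnitaryGroup.CotangentForms (toQuotFun toQuotFun_mk)
open Literature.NumberTheory.Automorphic.IdeleClassGroup Literature.NumberTheory.Automorphic.Liu2021 Literature.NumberTheory.Automorphic.Liu2021.AppendixC
open Literature.NumberTheory.GaloisRepresentations Literature.RepresentationTheory.Liu2021 Literature.RepresentationTheory.HarrisKudlaSweet1996
open Literature.AlgebraicGeometry.Liu2021 (IsAdmissibleElement)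
open Literature.NumberTheory.Weil1964 Literature.NumberTheory.GelbartRogawski1991 Literature.NumberTheory.GelbartRogawski1991.UnitaryDualPair Literature.NumberTheory.GelbartRogawski1991.UnitaryDualPair.WeilCoinv
open Literature.NumberTheory.GelbartRogawski1991.UnitaryDualPair.LocalSplitting
open Literature.NumberTheory.Automorphic.Liu2021.Def411WeilCarriersDoubling
open Literature.NumberTheory.Automorphic.Liu2021.Def411WeilCarriers (TW JW JW_eq isSymm_TW isUnit_det_TW Rep Eps epsOf Chi rhoVAtLine rhoAtLine omegaAtLine)
open Summit.HodgeConjecture.CorCM (CMField)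
open Summit.HodgeConjecture.CorCM.Lines.A3Liu418
open Summit.HodgeConjecture.HodgeConjecture.Cruxes.H413.F0P3HilbertProjection
open Summit.HodgeConjecture.HodgeConjecture.Cruxes.H413.SpectrumJunction
open Summit.HodgeConjecture.HodgeConjecture.Cruxes.HLiu418.ScalarSpectralJunction
open Summit.HodgeConjecture.HodgeConjecture.Cruxes.HLiu418.IntertwiningLineOfLetters
open Summit.HodgeConjecture.HodgeConjecture.Cruxes.HLiu418
open Summit.HodgeConjecture.HodgeConjecture.Cruxes.H413.F0P3HJ3aAssembly (left_eq_of_add_eq_add_of_disjoint right_eq_of_add_eq_add_of_disjoint)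
open Summit.HodgeConjecture.HodgeConjecture.Cruxes.HLiu418.S1MultOneFormsOfLetters

set_option synthInstance.maxHeartbeats 400000 in
set_option maxHeartbeats 4000000 in  -- as the ★ twin (the `ω⋆_lab` term)
/-- **HEAD — `S1MultOneFormsShape` MODULO FIVE LETTERS {E1θhol₂, E3nec-hol₂, E3nec-antihol₂, D₂h, E₂h}**: the `ω⋆_lab`-equivariant maps into the coherent
curve `1`-forms `cohForms₂ 𝔣` lie on one line.  = ★ N3 `F0AlbCmS1BettiHoldsSignedNoE1.s1MultOneForms_of_signed_letters'` with (L10)∕(L01) := ★ T3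
`S1BettiSliceLinesTheta.stub_L10_of_theta_letters ∕ stub_L01_of_theta_letters` and E1θantihol := ★ T2 `E1Theta.curveThetaCohFinComponentUnique_antihol_of_hol hE1θ`.  Conclusion = the body of the sub-sub-line's `S1MultOneFormsShape`, TOKEN FOR TOKEN.
HC_CM is proved only modulo the 7 printed citations until rung 0 closes.
[cite: Liu2021, Prop. D.4 (1) and proof (p. 130–131); Rem. D.5 (p. 131)] [cite: Rogawski1990, §11.1 Prop. 11.1.1; Thm. 11.5.1; §12.3]
[cite: BorelJacquet1979, §4.6] [cite: BorelWallach2000, VII 2.10, 3.2 and 3.6] -/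
theorem s1MultOneForms_of_theta_nec_letters_pos (hE1θ : Literature.NumberTheory.Rogawski1990.curveThetaCohFinComponentUnique_hol)
    (hE3hol : Literature.NumberTheory.Rogawski1990.curveThetaHodgeTypeNecessity_hol_pos)
    (hE3antihol : Literature.NumberTheory.Rogawski1990.curveThetaHodgeTypeNecessity_antihol_pos)
    (hDh : Literature.NumberTheory.Automorphic.UnitaryCurveForms.holCotFormSpectralProjection₂)
    (hEh : Literature.NumberTheory.Automorphic.UnitaryCurveForms.cohIsotypicLine₂_hol) :
      ∀ (F : CMField) [IsGalois ℚ F] (ι₁ : F →+* ℂ)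
        (μ : Literature.NumberTheory.Automorphic.IdeleClassGroup (F : Type) →ₜ* Circle)
        (hμ : IdeleClassGroup.IsConjugateSymplectic (F : Type) μ)
        (_hw : IdeleClassGroup.HasWeight (F : Type) μ 1)
        (Jstar : Matrix (Fin 2) (Fin 2) (F : Type)) (t : (F : Type)) (ht : t ≠ 0) (_hτt : 0 < (ι₁ t).re) (_hτt' : (ι₁ t).im = 0)
        (gstar : GL (Fin 2) (F : Type))
        (dJ : Fin 2 → (F : Type)) (hdJ : ∀ i, IsCMField.complexConj (F : Type) (dJ i) = dJ i) (hdJ0 : ∀ i, dJ i ≠ 0)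
        (hg : formCongr ((IsCMField.complexConj (F : Type) : (F : Type) ≃ₐ[↥(maximalRealSubfield (F : Type))] (F : Type)) :
            (F : Type) →+* (F : Type)) gstar (t • Jstar) = Matrix.diagonal dJ)
        (_hsig : (∃ Tstar : GL (Fin 2) ℂ,
            formCongr (starRingEnd ℂ) Tstar ((Matrix.diagonal dJ).map ι₁) = Matrix.diagonal ![(1 : ℂ), -1]) ∧
          ∀ τ' : (F : Type) →+* ℂ, InfinitePlace.mk τ' ≠ InfinitePlace.mk ι₁ → ((Matrix.diagonal dJ).map τ').PosDef)
        (h4 : 4 ≤ Module.finrank ℚ (F : Type))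
        (r : Rep ↥(maximalRealSubfield (F : Type)) (imagUnitSq F))
        (ε : Eps ↥(maximalRealSubfield (F : Type)) (imagUnitSq F))
        (_hadm : ∃ e : (F : Type), IsAdmissibleElement (F : Type) hμ.cmType.1 e ∧
          epsOf ↥(maximalRealSubfield (F : Type)) (imagUnitSq F) (F : Type) (2 * imagUnit (F : Type))⁻¹ (-e) = ε)
        (χ : Chi ↥(maximalRealSubfield (F : Type)) (F : Type) (IsCMField.complexConj (F : Type)))
        (𝔣 : ConeFrame (F : Type) Jstar (cmPlace (F : Type) ι₁)),
        ∃ ψ₀ : Representation.IntertwiningMap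
            ((rhoVAtLine ↥(maximalRealSubfield (F : Type)) (F : Type) (IsCMField.complexConj (F : Type)) 2
              (finProdFinEquiv : Fin 2 × Fin 1 ≃ Fin (2 * 1)) (Matrix.diagonal dJ)
              (complexConj_imagUnit F) (imagUnit_ne_zero F) (imagUnit_mul_self F) (realDiagonal_isSymm F dJ hdJ)
              (isUnit_det_realDiagonal F dJ hdJ hdJ0) (realDiagonal_map F dJ hdJ).symm
              (hsChiGS F finProdFinEquiv dJ hdJ hdJ0
                (toHeckeCharacter (F : Type) (galConj (IsCMField.complexConj (F : Type)) μ))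
                (isUnitary_toHeckeCharacter (F : Type) (galConj (IsCMField.complexConj (F : Type)) μ))
                ((isOscillatorChar_toHeckeCharacter_iff (galConj (IsCMField.complexConj (F : Type)) μ)).mpr hμ.galConj))
              (r.toFun ε) χ).comp
              (finAdelicCongr ↥(maximalRealSubfield (F : Type)) (F : Type) (IsCMField.complexConj (F : Type)) gstar ht hg).symm.toMonoidHom)
            (rightRep₂ ↥(maximalRealSubfield (F : Type)) (F : Type) (IsCMField.complexConj (F : Type)) Jstar),
          ∀ ψ : Representation.IntertwiningMap
            ((rhoVAtLine ↥(maximalRealSubfield (F : Type)) (F : Type) (IsCMField.complexConj (F : Type)) 2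
              (finProdFinEquiv : Fin 2 × Fin 1 ≃ Fin (2 * 1)) (Matrix.diagonal dJ)
              (complexConj_imagUnit F) (imagUnit_ne_zero F) (imagUnit_mul_self F) (realDiagonal_isSymm F dJ hdJ)
              (isUnit_det_realDiagonal F dJ hdJ hdJ0) (realDiagonal_map F dJ hdJ).symm
              (hsChiGS F finProdFinEquiv dJ hdJ hdJ0
                (toHeckeCharacter (F : Type) (galConj (IsCMField.complexConj (F : Type)) μ))
                (isUnitary_toHeckeCharacter (F : Type) (galConj (IsCMField.complexConj (F : Type)) μ))
                ((isOscillatorChar_toHeckeCharacter_iff (galConj (IsCMField.complexConj (F : Type)) μ)).mpr hμ.galConj))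
              (r.toFun ε) χ).comp
              (finAdelicCongr ↥(maximalRealSubfield (F : Type)) (F : Type) (IsCMField.complexConj (F : Type)) gstar ht hg).symm.toMonoidHom)
            (rightRep₂ ↥(maximalRealSubfield (F : Type)) (F : Type) (IsCMField.complexConj (F : Type)) Jstar),
          (∀ w, ψ w ∈ cohForms₂ ↥(maximalRealSubfield (F : Type)) (F : Type) (IsCMField.complexConj (F : Type)) Jstar
              (IsCMField.complexConj_ne_one (F : Type)) (UnitaryGroup.complexConj_smul_infinitePlace (F : Type))
              (cmPlace (F : Type) ι₁) 𝔣) → ∃ a : ℂ, ψ = a • ψ₀ := by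
  intro F _ ι₁ μ hμ hw Jstar t ht hτt hτt' gstar dJ hdJ hdJ0 hg hsig h4 r ε hadm χ 𝔣
  obtain ⟨hAB, hA, hB⟩ := CurveHodgeTypesDisjoint.hodgeTypes₂_disjoint_stable ↥(maximalRealSubfield (F : Type)) (F : Type)
    (IsCMField.complexConj (F : Type)) Jstar (IsCMField.complexConj_ne_one (F : Type)) (UnitaryGroup.complexConj_smul_infinitePlace (F : Type))
    (cmPlace (F : Type) ι₁) (CurveHodgeTypesDisjoint.isHermitian_map_of_formCongr (F : Type) ι₁ Jstar t ht hτt' gstar dJ hdJ hg _) 𝔣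
  exact exists_line_of_split _ _ _ _ hAB hA hB
    (S1BettiSliceLinesTheta.stub_L10_of_theta_letters hE1θ hDh hEh F ι₁ μ hμ hw Jstar t ht hτt hτt' gstar dJ hdJ hdJ0 hg hsig h4 r ε hadm χ 𝔣)
    (S1BettiSliceLinesTheta.stub_L01_of_theta_letters
      (E1Theta.curveThetaCohFinComponentUnique_antihol_of_hol hE1θ)
      (Literature.NumberTheory.Automorphic.UnitaryCurveForms.antiholCotFormSpectralProjection₂_of_hol hDh)
      (Literature.NumberTheory.Automorphic.UnitaryCurveForms.cohIsotypicLine₂_antihol_of_hol hEh)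
      F ι₁ μ hμ hw Jstar t ht hτt hτt' gstar dJ hdJ hdJ0 hg hsig h4 r ε hadm χ 𝔣)
    (S1BettiSliceExclusionNecPos.stub_X_of_nec_letters_pos hE3hol hE3antihol hDh
      (Literature.NumberTheory.Automorphic.UnitaryCurveForms.antiholCotFormSpectralProjection₂_of_hol hDh)
      F ι₁ μ hμ hw Jstar t ht hτt hτt' gstar dJ hdJ hdJ0 hg hsig h4 r ε hadm χ 𝔣)

/-- **`stub_S1_betti_holds_theta_nec` — the parent's `stub_S1_betti : S1BettiShape` MODULO THE FIVE NAMED FACTS {E1θhol, E3nec-hol, E3nec-antihol, TPhol, E₂hol}** (E1θhol = [Liu2021, Prop. D.4 (1)] «≤ 1» half, E3nec = [Liu2021, Rem. D.5] «only if» half)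
(E2′ `curveThetaHodgeTypeRigid` NOT among them): ★ `F0AlbCmS1BettiHolds.s1BettiShape_of` at ★ `F0AlbCmS1BettiHolds.stub_S1_realisation` and HEAD‴
`s1MultOneForms_of_theta_nec_letters_pos`.  [Liu2021, Prop. D.4 (1)]: `dim Hom_{ℂ[G]}(ω⋆, H¹_B) ≤ 1`.  HC_CM is proved only modulo the 7 printed citations until rung 0 closes.
[cite: Liu2021, Prop. D.4 (1) and proof (p. 130–131); Rem. D.5 (p. 131); §D.2 (D.1)] [cite: Rogawski1990, §11.1 Prop. 11.1.1; Thm. 11.5.1]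
[cite: BorelWallach2000, VII 3.2] -/
theorem stub_S1_betti_holds_theta_nec_pos (hE1θ : Literature.NumberTheory.Rogawski1990.curveThetaCohFinComponentUnique_hol)
    (hE3hol : Literature.NumberTheory.Rogawski1990.curveThetaHodgeTypeNecessity_hol_pos)
    (hE3antihol : Literature.NumberTheory.Rogawski1990.curveThetaHodgeTypeNecessity_antihol_pos)
    (hDh : Literature.NumberTheory.Automorphic.UnitaryCurveForms.holCotFormSpectralProjection₂)
    (hEh : Literature.NumberTheory.Automorphic.UnitaryCurveForms.cohIsotypicLine₂_hol) : F0AlbCmS1BettiHolds.S1BettiShape :=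
  F0AlbCmS1BettiHolds.s1BettiShape_of F0AlbCmS1BettiHolds.stub_S1_realisation
    (s1MultOneForms_of_theta_nec_letters_pos hE1θ hE3hol hE3antihol hDh hEh)

/-- **`stub_S1_betti_holds_theta_nec_pos_of_hol_pos` — the parent's `stub_S1_betti : S1BettiShape` from E1θhol, E3nec-hol, TPhol, E₂hol ONLY** (the antihol necessity supplied
by ★ T1′ `E3NecessityPos.curveThetaHodgeTypeNecessity_antihol_pos_of_hol_pos`). [cite: Liu2021, Prop. D.4 (1) and proof (p. 130–131); Rem. D.5 (p. 131)] -/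
theorem stub_S1_betti_holds_theta_nec_pos_of_hol_pos (hE1θ : Literature.NumberTheory.Rogawski1990.curveThetaCohFinComponentUnique_hol)
    (hE3hol : Literature.NumberTheory.Rogawski1990.curveThetaHodgeTypeNecessity_hol_pos)
    (hDh : Literature.NumberTheory.Automorphic.UnitaryCurveForms.holCotFormSpectralProjection₂)
    (hEh : Literature.NumberTheory.Automorphic.UnitaryCurveForms.cohIsotypicLine₂_hol) : F0AlbCmS1BettiHolds.S1BettiShape :=
  stub_S1_betti_holds_theta_nec_pos hE1θ hE3hol (E3NecessityPos.curveThetaHodgeTypeNecessity_antihol_pos_of_hol_pos hE3hol) hDh hEh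

end Summit.HodgeConjecture.HodgeConjecture.Cruxes.HLiu418.F0AlbCmS1BettiHoldsSignedThetaNecPos

end
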